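import Mathlib.Analysis.SpecialFunctions.Log.Basic
import Mathlib.Topology.Algebra.InfiniteSum.Basic
import Mathlib.Topology.Instances.ENNReal.Lemmas
import Literature.Probability.LatticeModels.LatticeGraph
import Literature.Probability.LatticeModels.ThermodynamicLimit
import Literature.Probability.LatticeModels.Correlations
import Literature.Probability.LatticeModels.CorrelationDecay
import Literature.Probability.LatticeModels.IsingModel
import HarnessLib

-- provenance: harness21/H21/H21/Prelude/StatMech/IsingThermodynamics.lean @ b9d4e5c (interim HEAD d8f2665); M5 mechanical rewrite
/-!
# Ising thermodynamics: pressure, infinite-volume states, magnetisation, `β_c`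

Trunk G02 (T-STATMECH), prelude item P6 `IsingThermodynamics` (notions
`partition_function_free_energy`, `critical_point_beta_c`).

On the hypercubic lattice `zdGraph d` with boxes `box d L = {-L,…,L}^d` we define

* the finite-volume pressure `pressureIn G Λ β h bc = log Z_{Λ;β,h}^{bc} / |Λ|`, its thermodynamic
  limit `pressure d β h` (free b.c. along boxes; independent of the b.c. by
  `hasBoxLimit_pressureIn`, Friedli–Velenik Thm 3.6) and the free energy `freeEnergy = -ψ/β`;
* the infinite-volume states `⟨·⟩⁺_{β,h}`, `⟨·⟩⁻_{β,h}`, `⟨·⟩^∅_{β,h}` as limit functionals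
  `plusExpect`, `minusExpect`, `freeExpect` on observables `SpinConfig (Site d) → ℝ`
  (Friedli–Velenik §3.4, Thm 3.17), and the correlations `plusCorr` etc.;
* the spontaneous magnetisation `m*(β) = ⟨σ₀⟩⁺_{β,0}`, the magnetisation in a field, the
  two-point functions `⟨σ₀σ_x⟩⁺_{β,0}`, `⟨σ₀σ_x⟩^∅_{β,0}` (expectations of *products*, `= 1` at
  `x = 0`), the susceptibility `χ(β) = ∑_x ⟨σ₀σ_x⟩^∅_{β,0}` (in `ℝ≥0∞`), the critical inverse
  temperature `β_c(d) = inf {β ≥ 0 | m*(β) > 0}`, the correlation length and the critical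
  correlators.

## Design

* Thermodynamic limits (outline D2): infinite-volume *values* are `Filter.limUnder atTop` of the
  box sequence (junk if divergent, documented on each definition), accompanied by the existence
  theorems `hasBoxLimit_pressureIn`, `hasBoxLimit_isingCorr_plus`, `hasBoxLimit_isingCorr_free`
  (known in print; proofs `sorry`).
* Two-point functions are expectations of products `spinPair 0 x` (outline §0), critical
  `n`-point correlators are expectations of `spinMonomial x` (correct at coincident points); the
  type of `criticalCorr d` is the Pi type `(n : ℕ) → (Fin n → Site d) → ℝ` (= `LatticeCorrFamily d`
  of P8, not imported here).
* `susceptibility` is `ℝ≥0∞`-valued (`∑'` of `ENNReal.ofReal`), so that `χ = ∞` is a genuine value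
  and no summability side condition is needed; by GKS the summands are nonnegative.
* `criticalBeta d = sInf {β | 0 ≤ β ∧ 0 < m*(β)}`; for `d = 1` the set is empty and `sInf ∅ = 0`
  is junk — statements about `β_c` carry `2 ≤ d`.

## Mathlib status

Mathlib has no pressure / free energy / Gibbs state / magnetisation / critical temperature for
lattice systems (grep for `partitionFunction`, `freeEnergy`, `magnetization`, `pressure` finds
nothing relevant). Anchors used verbatim: `Real.log`, `Filter.limUnder`, `tsum`, `ENNReal.ofReal`,
`sInf` on `ℝ` (`Real.sInf_empty`).

## References

* S. Friedli, Y. Velenik, *Statistical Mechanics of Lattice Systems* (CUP 2017), §3.2.1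
  (pressure, Def. 3.5, Thm. 3.6), §3.4 (infinite-volume states `⟨·⟩⁺`, Thm. 3.17), §3.6–3.7
  (GKS, magnetisation, `β_c`, Def. 3.29, Thm. 3.25), §3.7.4 and §3.10.7 (susceptibility,
  correlation length).
* B. Simon, *The Statistical Mechanics of Lattice Gases* I (Princeton 1993), §II.12.
-/

noncomputable section

open MeasureTheory Filter Topology Finset
open scoped ENNReal

namespace Literature.Probability.LatticeModels

/-! ### Pressure and free energy -/

section Pressure

variable {V : Type*} (G : SimpleGraph V) [DecidableEq V] [G.LocallyFinite]

/-- The finite-volume pressure `ψ_Λ^{bc}(β,h) = log Z_{Λ;β,h}^{bc} / |Λ|`. Junk value `0` for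
`Λ = ∅` (division convention). (Friedli–Velenik 2017, §3.2.1, Definition 3.5 / eq. (3.13).) [cite: FriedliVelenik2017, §3.2.1  Definition 3.5 / eq. (3.13] -/
def pressureIn (Λ : Finset V) (β h : ℝ) (bc : BoundaryCondition V) : ℝ :=
  Real.log (isingPartitionFunction G Λ β h bc) / (#Λ : ℝ)

/-- `pressureIn` is the per-site density of `log Z` (Friedli–Velenik 2017, Definition 3.5). [cite: FriedliVelenik2017, Definition 3.5] -/
theorem pressureIn_eq_perSite (Λ : Finset V) (β h : ℝ) (bc : BoundaryCondition V) :
    pressureIn G Λ β h bc =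
      perSite (fun Λ' => Real.log (isingPartitionFunction G Λ' β h bc)) Λ := rfl

end Pressure

variable (d : ℕ)

/-- The (infinite-volume) pressure `ψ(β,h) = lim_{L → ∞} log Z_{B(L);β,h}^∅ / |B(L)|` of the
Ising model on `ℤ^d`, defined as `limUnder` of the free-boundary-condition box sequence.
**Junk-valued** if the sequence diverges (it does not: `hasBoxLimit_pressureIn`).
(Friedli–Velenik 2017, §3.2.1, Theorem 3.6.) [cite: FriedliVelenik2017, §3.2.1  Theorem 3.6] -/
def pressure (β h : ℝ) : ℝ :=
  limUnder atTop fun L : ℕ => pressureIn (zdGraph d) (box d L) β h .free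

/-- Existence of the pressure and independence of the boundary condition: for every boundary
condition `bc`, `log Z_{B(L);β,h}^{bc} / |B(L)| → ψ(β,h)` as `L → ∞`.
(Friedli–Velenik 2017, Theorem 3.6.) [cite: FriedliVelenik2017, Theorem 3.6] -/
def hasBoxLimit_pressureIn : Prop :=
  ∀ (β h : ℝ) (bc : BoundaryCondition (Site d)),
    HasBoxLimit (fun Λ => pressureIn (zdGraph d) Λ β h bc) (pressure d β h)

/-- The free energy per site `f(β,h) = -ψ(β,h) / β`. Junk value `0` at `β = 0` (division
convention). (Friedli–Velenik 2017, §3.2.1, footnote to Definition 3.5; Simon 1993, §II.3.) [cite: FriedliVelenik2017, §3.2.1  footnote to Definition 3.5] -/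
def freeEnergy (β h : ℝ) : ℝ :=
  -(pressure d β h) / β

/-! ### Infinite-volume states as limit functionals -/

/-- The plus state `⟨f⟩⁺_{β,h} = lim_{L → ∞} ⟨f⟩_{B(L);β,h}^+` as a functional on observables
`f : SpinConfig (Site d) → ℝ`, defined by `limUnder` along boxes. **Junk-valued** when the box
sequence does not converge; it converges for every local `f` when `0 ≤ β`, `0 ≤ h`
(Friedli–Velenik 2017, §3.4, Theorem 3.17; see `hasBoxLimit_isingCorr_plus`). [cite: FriedliVelenik2017, §3.4  Theorem 3.17] -/
def plusExpect (β h : ℝ) (f : SpinConfig (Site d) → ℝ) : ℝ :=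
  limUnder atTop fun L : ℕ => isingExpect (zdGraph d) (box d L) β h .plus f

/-- The minus state `⟨f⟩⁻_{β,h} = lim_{L → ∞} ⟨f⟩_{B(L);β,h}^-` (by `limUnder`; **junk-valued**
if divergent). (Friedli–Velenik 2017, §3.4, Theorem 3.17.) [cite: FriedliVelenik2017, §3.4  Theorem 3.17] -/
def minusExpect (β h : ℝ) (f : SpinConfig (Site d) → ℝ) : ℝ :=
  limUnder atTop fun L : ℕ => isingExpect (zdGraph d) (box d L) β h .minus f

/-- The free state `⟨f⟩^∅_{β,h} = lim_{L → ∞} ⟨f⟩_{B(L);β,h}^∅` (by `limUnder`; **junk-valued**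
if divergent; converges for local `f` when `0 ≤ β`, `0 ≤ h` by GKS, see
`hasBoxLimit_isingCorr_free`). (Friedli–Velenik 2017, §3.6, Exercise 3.16 / Theorem 3.25.) [cite: FriedliVelenik2017, §3.6  Exercise 3.16 / Theorem 3.25] -/
def freeExpect (β h : ℝ) (f : SpinConfig (Site d) → ℝ) : ℝ :=
  limUnder atTop fun L : ℕ => isingExpect (zdGraph d) (box d L) β h .free f

/-- The plus-state correlation `⟨σ_A⟩⁺_{β,h}` of a finite set of sites
(Friedli–Velenik 2017, §3.6.1). [cite: FriedliVelenik2017, §3.6.1] -/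
def plusCorr (β h : ℝ) (A : Finset (Site d)) : ℝ :=
  plusExpect d β h (spinProduct A)

/-- The minus-state correlation `⟨σ_A⟩⁻_{β,h}` (Friedli–Velenik 2017, §3.6.1). [cite: FriedliVelenik2017, §3.6.1] -/
def minusCorr (β h : ℝ) (A : Finset (Site d)) : ℝ :=
  minusExpect d β h (spinProduct A)

/-- The free-state correlation `⟨σ_A⟩^∅_{β,h}` (Friedli–Velenik 2017, §3.6.1). [cite: FriedliVelenik2017, §3.6.1] -/
def freeCorr (β h : ℝ) (A : Finset (Site d)) : ℝ :=
  freeExpect d β h (spinProduct A)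

/-- Existence of the plus state on local spin products: for `β ≥ 0`, `h ≥ 0` and every finite
`A`, `⟨σ_A⟩_{B(L);β,h}^+` is eventually nonincreasing in `L` (GKS/FKG) and converges to
`⟨σ_A⟩⁺_{β,h}`. (Friedli–Velenik 2017, Theorem 3.17 and Exercise 3.15.) [cite: FriedliVelenik2017, Theorem 3.17 and Exercise 3.15] -/
def hasBoxLimit_isingCorr_plus : Prop :=
  ∀ {β h : ℝ} (hβ : 0 ≤ β) (hh : 0 ≤ h) (A : Finset (Site d)),
    HasBoxLimit (fun Λ => isingCorr (zdGraph d) Λ β h .plus A) (plusCorr d β h A)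

/-- Existence of the free state on local spin products: for `β ≥ 0`, `h ≥ 0` and every finite
`A`, `⟨σ_A⟩_{B(L);β,h}^∅` is eventually nondecreasing in `L` (second Griffiths inequality) and
converges to `⟨σ_A⟩^∅_{β,h}`. (Friedli–Velenik 2017, Exercise 3.16; Simon 1993, §II.12.) [cite: FriedliVelenik2017, Exercise 3.16] -/
def hasBoxLimit_isingCorr_free : Prop :=
  ∀ {β h : ℝ} (hβ : 0 ≤ β) (hh : 0 ≤ h) (A : Finset (Site d)),
    HasBoxLimit (fun Λ => isingCorr (zdGraph d) Λ β h .free A) (freeCorr d β h A)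

/-! ### Magnetisation, two-point functions, susceptibility, `β_c` -/

/-- The spontaneous magnetisation `m*(β) = ⟨σ₀⟩⁺_{β,0}` (Friedli–Velenik 2017, §3.7, eq. (3.41)
and Proposition 3.29, which identifies it with the right derivative of the pressure at `h = 0`). [cite: FriedliVelenik2017, §3.7  eq. (3.41] -/
def spontaneousMagnetization (β : ℝ) : ℝ :=
  plusExpect d β 0 (spinAt 0)

/-- The magnetisation in a field, `m(β,h) = ⟨σ₀⟩⁺_{β,h}` (Friedli–Velenik 2017, §3.7.3,
Theorem 3.43). [cite: FriedliVelenik2017, §3.7.3  Theorem 3.43] -/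
def magnetizationInField (β h : ℝ) : ℝ :=
  plusExpect d β h (spinAt 0)

/-- `m*(β) = m(β, 0)` (Friedli–Velenik 2017, §3.7). [cite: FriedliVelenik2017, §3.7] -/
theorem magnetizationInField_zero (β : ℝ) :
    magnetizationInField d β 0 = spontaneousMagnetization d β := rfl

/-- `m*(β) ≥ 0` for `β ≥ 0` (first Griffiths inequality in the limit)
(Friedli–Velenik 2017, §3.6–3.7). [cite: FriedliVelenik2017, §3.6–3.7] -/
def spontaneousMagnetization_nonneg : Prop :=
  ∀ {β : ℝ} (hβ : 0 ≤ β),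
    0 ≤ spontaneousMagnetization d β

/-- `m*(β) ≤ 1` for `β ≥ 0` (`|σ₀| = 1`) (Friedli–Velenik 2017, §3.7). [cite: FriedliVelenik2017, §3.7] -/
def spontaneousMagnetization_le_one : Prop :=
  ∀ {β : ℝ} (hβ : 0 ≤ β),
    spontaneousMagnetization d β ≤ 1

/-- `β ↦ m*(β)` is nondecreasing on `[0, ∞)` (second Griffiths inequality)
(Friedli–Velenik 2017, §3.7.2, Exercise 3.29). [cite: FriedliVelenik2017, §3.7.2  Exercise 3.29] -/
def spontaneousMagnetization_mono : Prop :=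
  MonotoneOn (spontaneousMagnetization d) (Set.Ici 0)

/-- The plus-state two-point function at zero field, `⟨σ₀ σ_x⟩⁺_{β,0}`, an expectation of the
product `σ₀ σ_x` (so `= 1` at `x = 0`) (Friedli–Velenik 2017, §3.7.4). [cite: FriedliVelenik2017, §3.7.4] -/
def twoPointPlus (β : ℝ) (x : Site d) : ℝ :=
  plusExpect d β 0 (spinPair 0 x)

/-- The free-state two-point function at zero field, `⟨σ₀ σ_x⟩^∅_{β,0}`, an expectation of the
product `σ₀ σ_x` (so `= 1` at `x = 0`) (Friedli–Velenik 2017, §3.7.4; Simon 1993, §II.12). [cite: FriedliVelenik2017, §3.7.4] -/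
def twoPointFree (β : ℝ) (x : Site d) : ℝ :=
  freeExpect d β 0 (spinPair 0 x)

/-- The magnetic susceptibility at zero field, `χ(β) = ∑_{x ∈ ℤ^d} ⟨σ₀ σ_x⟩^∅_{β,0} ∈ [0, ∞]`
(including the term `x = 0`, equal to `1`), as an extended nonnegative real: the summands are
nonnegative by the first Griffiths inequality, and `χ(β) = ∞` is a genuine value (e.g. for
`β ≥ β_c`). (Friedli–Velenik 2017, §3.7.4, eq. (3.67); Aizenman–Barsky–Fernández 1987.) [cite: FriedliVelenik2017, §3.7.4  eq. (3.67] -/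
def susceptibility (β : ℝ) : ℝ≥0∞ :=
  ∑' x : Site d, ENNReal.ofReal (twoPointFree d β x)

/-- The critical inverse temperature `β_c(d) = inf {β ≥ 0 | m*(β) > 0}`
(Friedli–Velenik 2017, Definition 3.29 / Theorem 3.25). **Junk value**: for `d = 1` (and `d = 0`)
there is no spontaneous magnetisation, the set is empty and `sInf ∅ = 0` in `ℝ`; statements about
`criticalBeta d` assume `2 ≤ d`, where `0 < β_c(d) < ∞`. [cite: FriedliVelenik2017, Definition 3.29 / Theorem 3.25] -/
def criticalBeta : ℝ :=
  sInf {β : ℝ | 0 ≤ β ∧ 0 < spontaneousMagnetization d β}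

/-- `β_c(d) ≥ 0` (all members of the defining set are `≥ 0`, and `sInf ∅ = 0`)
(Friedli–Velenik 2017, Definition 3.29). [cite: FriedliVelenik2017, Definition 3.29] -/
theorem criticalBeta_nonneg : 0 ≤ criticalBeta d :=
  Real.sInf_nonneg fun _ hβ => hβ.1

/-- The correlation length `ξ(β)` of the plus-state two-point function along the first axis,
`ξ(β)⁻¹ = liminf -log ⟨σ₀ σ_{n e₁}⟩⁺_{β,0} / n` (junk conventions as in `corrLength`)
(Friedli–Velenik 2017, §3.10.7). [cite: FriedliVelenik2017, §3.10.7] -/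
def isingCorrLength [NeZero d] (β : ℝ) : ℝ :=
  corrLength (twoPointPlus d β)

/-- The critical two-point function `⟨σ₀ σ_x⟩⁺_{β_c,0}` (Friedli–Velenik 2017, §3.10.7). [cite: FriedliVelenik2017, §3.10.7] -/
def criticalTwoPoint (x : Site d) : ℝ :=
  twoPointPlus d (criticalBeta d) x

/-- The family of critical `n`-point correlators `⟨∏ᵢ σ_{xᵢ}⟩⁺_{β_c,0}` on `ℤ^d`, indexed by
`n` and `x : Fin n → Site d`, as expectations of spin monomials (repetitions allowed, so the
values at coincident points are the correct ones, `σ_x² = 1`). This has the shape of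
`LatticeCorrFamily d` of the scaling-limit prelude. (Glimm–Jaffe 1987, §4.2;
Friedli–Velenik 2017, §3.10.) [cite: GlimmJaffe1987, §4.2] -/
def criticalCorr : (n : ℕ) → (Fin n → Site d) → ℝ :=
  fun _ x => plusExpect d (criticalBeta d) 0 (spinMonomial x)

/-- The critical two-point function is the `n = 2` critical correlator at `(0, x)`
(Friedli–Velenik 2017, §3.10). [cite: FriedliVelenik2017, §3.10] -/
theorem criticalCorr_two (x : Site d) :
    criticalCorr d 2 ![0, x] = criticalTwoPoint d x := by
  simp only [criticalCorr, criticalTwoPoint, twoPointPlus]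
  congr 1
  funext s
  simp [spinMonomial, spinPair, Fin.prod_univ_two]

end Literature.Probability.LatticeModels
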